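import Summits.ResolutionOfSingularities.ResolutionOfSingularities.Theorems.WildQuotientsSummitReductionStubPairNodeThickness
import Summits.ResolutionOfSingularities.ResolutionOfSingularities.Theorems.WildQuotientsSummitReductionStubPairSsCodimThreeOrbit
import Literature.AlgebraicGeometry.Resolution.AlterationsSemiStableCodimTwo
import Literature.AlgebraicGeometry.Motives.SubschemeCyclesRatStalkProofs
import HarnessLib

/-!
# `WildQuotients.SummitReduction` (stmt-ResolutionOfSingularities-16324), line `FramePerfect`, skeleton v8:
# helper lemmas for stub `stub_pair_orbitBlowupCentreNew` (C3) — orbit geometry of a codimension-2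
# singular point of a `G`-STRICT semi-stable pair (de Jong 1997, proof of Prop. 5.11, ¶1)

Route `ResolutionOfSingularities/WildQuotients`, crux `SummitReduction`; worker file supporting the
registered stub `stub_pair_orbitBlowupCentreNew` of the line skeleton (v8, lead c4).

De Jong 1997, proof of 5.11 (p. 618): "Since `D` is a `G`-strict normal crossings divisor … the
union `T' = ∪ g(T)` is a disjoint union of nonsingular `T`". This file proves the TOPOLOGICAL half of
that remark for the orbit `G · x` of a codimension-`≤ 2` singular point `x` of the curve `f : X ⟶ Y`
of a `G`-semi-stable pair of the line, in the binder conventions of the line: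

* `centreNew_closure_orbit_eq_iUnion`, `centreNew_mem_closure_orbit_iff` — `cl(G · x) = ⋃_g cl{g x}`
  (a finite union), so `z ∈ cl(G · x)` iff some translate `g x` specializes to `z`;
* `centreNew_eq_of_specializes_of_ringKrullDim` — a codimension-`≤ 2` point in the closure of a point
  whose local ring has dimension `≥ 2` is that point (`dim` drops strictly under specialization);
* `centreNew_maximal_closure_singleton` — for a strict normal crossings divisor `D` on a regular
  locally Noetherian `Y`, the closure of a point `η ∈ D` with `dim 𝒪_{Y,η} ≤ 1` (the generic point of a
  component `Dᵢ`) is an irreducible component of `D` (a `Maximal` irreducible subset, the format of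
  the `G`-strictness hypothesis `hDstrict`);
* `centreNew_apply_eq_of_specializes` — **`G`-strictness at work**: if two translates `g x`, `g' x`
  both specialize to a point `z`, then `f (g x) = f (g' x)`: the components `cl{f(g x)}` and
  `cl{f(g' x)} = h · cl{f(g x)}` (`h = g' g⁻¹`) of `D` meet at `f z`, so they coincide by strictness;
* `centreNew_stalkSpecializes_comp_stalkMap_eq` — bookkeeping for a commutative square of schemes
  read on stalks (both ways round the square from `𝒪_{X,z}` agree), and
  `centreNew_stalkSpecializes_stalkMap_fromSpecStalk` — along `Spec 𝒪_{X,z} → X` the composite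
  `𝒪_{X,z} → 𝒪_{X,x_𝔮} → 𝒪_{Spec 𝒪_{X,z}, 𝔮}` is the localization map (Stacks 01J7).
-/

set_option linter.dupNamespace false

noncomputable section

open CategoryTheory CategoryTheory.Limits AlgebraicGeometry TopologicalSpace Topology
open Literature.AlgebraicGeometry.Resolution
open Literature.AlgebraicGeometry
open IsLocalRing

namespace Summit.ResolutionOfSingularities.ResolutionOfSingularities.Theorems

universe u

/-! ## The orbit closure is the union of the closures of the translates -/

/-- `cl(G · x) = ⋃_g cl{g x}` for a finite group `G` (closure of a finite union). [folklore] -/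
theorem centreNew_closure_orbit_eq_iUnion {X : Scheme.{0}} {G : Type} [Group G] [Finite G]
    (ρ : G →* Aut X) (x : X) :
    closure (Set.range fun g : G => (ρ g).hom.base x) = ⋃ g : G, closure {(ρ g).hom.base x} := by
  rw [← Set.iUnion_singleton_eq_range, closure_iUnion_of_finite]

/-- `z ∈ cl(G · x)` iff some translate `g x` specializes to `z`. [folklore] -/
theorem centreNew_mem_closure_orbit_iff {X : Scheme.{0}} {G : Type} [Group G] [Finite G]
    (ρ : G →* Aut X) (x z : X) :
    z ∈ closure (Set.range fun g : G => (ρ g).hom.base x) ↔ ∃ g : G, (ρ g).hom.base x ⤳ z := by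
  rw [centreNew_closure_orbit_eq_iUnion, Set.mem_iUnion]
  simp only [specializes_iff_mem_closure]

/-! ## Codimension bookkeeping -/

/-- On a locally Noetherian scheme, a point `w` with `dim 𝒪_{X,w} ≤ 2` in the closure of a point `x'`
with `dim 𝒪_{X,x'} ≥ 2` is `x'` itself (`dim 𝒪` drops strictly under proper specialization).
[folklore] -/
theorem centreNew_eq_of_specializes_of_ringKrullDim {X : Scheme.{u}} [IsLocallyNoetherian X]
    {x' w : X} (h : x' ⤳ w) (h2 : (2 : WithBot ℕ∞) ≤ ringKrullDim (X.presheaf.stalk x'))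
    (hw : ringKrullDim (X.presheaf.stalk w) ≤ 2) : w = x' := by
  by_contra hne
  have hlt := ringKrullDim_stalk_lt_of_specializes h (Ne.symm hne)
  exact absurd (lt_of_le_of_lt h2 (lt_of_lt_of_le hlt hw)) (lt_irrefl _)

/-! ## The components of a strict normal crossings divisor through their generic points -/

/-- **The closure of the generic point of a component of a strict normal crossings divisor is an
irreducible component of it.** For `Y` regular and locally Noetherian, `D ⊆ Y` a strict normal
crossings divisor and `η ∈ D` with `dim 𝒪_{Y,η} ≤ 1`: `cl{η}` is a maximal irreducible subset of `D`
(a larger irreducible subset of `D` has a generic point `ξ ⤳ η` in `D`; if `ξ ≠ η` then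
`dim 𝒪_{Y,ξ} < 1`, `𝒪_{Y,ξ}` is a field and `ξ ∉ D`). [folklore] -/
theorem centreNew_maximal_closure_singleton {Y : Scheme.{0}} [IsLocallyNoetherian Y]
    (hreg : Scheme.IsRegular Y) {D : Set Y} (hD : IsStrictNormalCrossingsDivisor Y D) {η : Y}
    (hη : η ∈ D) (hdim : ringKrullDim (Y.presheaf.stalk η) ≤ 1) :
    Maximal (fun C : Set Y => IsIrreducible C ∧ C ⊆ D) (closure {η}) := by
  refine ⟨⟨isIrreducible_singleton.closure, closure_minimal (Set.singleton_subset_iff.mpr hη) hD.isClosed⟩,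
    fun C' hC' hle => ?_⟩
  obtain ⟨hirr, hsub⟩ := hC'
  -- the generic point `ξ` of `cl C'` specializes to `η` and lies on `D`
  set ξ := hirr.genericPoint with hξdef
  have hξ : closure ({ξ} : Set Y) = closure C' := hirr.genericPoint_closure_eq
  have hηC : η ∈ closure C' := subset_closure (hle (subset_closure (Set.mem_singleton η)))
  have hsp : ξ ⤳ η := by
    rw [specializes_iff_mem_closure, hξ]
    exact hηC
  have hξD : ξ ∈ D := by
    have : ξ ∈ closure C' := by rw [← hξ]; exact subset_closure (Set.mem_singleton ξ)
    exact closure_minimal hsub hD.isClosed this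
  -- `ξ = η`, else `𝒪_{Y,ξ}` is a field
  have hξη : ξ = η := by
    by_contra hne
    have hlt := ringKrullDim_stalk_lt_of_specializes hsp hne
    have h0 : ringKrullDim (Y.presheaf.stalk ξ) < 1 := lt_of_lt_of_le hlt hdim
    haveI : IsRegularLocalRing (Y.presheaf.stalk ξ) := hreg ξ
    haveI : IsDomain (Y.presheaf.stalk ξ) := isDomain_of_isRegularLocalRing _
    haveI : Ring.KrullDimLE 0 (Y.presheaf.stalk ξ) := by
      rw [Ring.krullDimLE_iff]
      exact Order.le_of_lt_succ (by exact_mod_cast h0)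
    exact notMem_of_isField_stalk_of_sncd hD (Ring.KrullDimLE.isField_of_isDomain) hξD
  -- hence `C' ⊆ cl C' = cl{ξ} = cl{η}`
  intro y hy
  rw [← hξη, hξ]
  exact subset_closure hy

/-! ## `G`-strictness: translates of `x` through a common point lie over the same point of `Y` -/

/-- **De Jong 1997, proof of 5.11 ¶1 — `G`-strictness at work.** For the curve `f : X ⟶ Y` of a
`G`-semi-stable pair of the line (`Y` regular locally Noetherian, `D` a `G`-stable `G`-STRICT strict
normal crossings divisor, `f` equivariant) and a point `x` over a point `f x ∈ D` with
`dim 𝒪_{Y,f x} ≤ 1` (e.g. a codimension-2 singular point): if two translates `g x`, `g' x` both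
specialize to a point `z`, then `f (g x) = f (g' x)`. Indeed `cl{f(g x)}` is an irreducible component
of `D` (`centreNew_maximal_closure_singleton`) and `cl{f(g' x)}` is its translate by `h = g' g⁻¹`; both
contain `f z`, so by strictness ("a component `C` of `D` with `C ∩ hC ≠ ∅` has `hC = C`", de Jong
1996, 7.1) they are equal, and so are their generic points. "Since `D` is a `G`-strict normal
crossings divisor … `T' = ∪ g(T)` is a disjoint union". [cite: DeJong1997, proof of Prop. 5.11, p. 618]
[cite: DeJong1996, 7.1, p. 88] -/
theorem centreNew_apply_eq_of_specializes {X Y : Scheme.{0}} [IsLocallyNoetherian Y]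
    (hreg : Scheme.IsRegular Y) {D : Set Y} (hD : IsStrictNormalCrossingsDivisor Y D) {G : Type}
    [Group G] (ρY : G →* Aut Y) (hDG : ∀ g : G, (ρY g).hom.base '' D = D)
    (hDstrict : ∀ (g : G) (C : Set Y), Maximal (fun C : Set Y => IsIrreducible C ∧ C ⊆ D) C →
      (C ∩ (ρY g).hom.base '' C).Nonempty → (ρY g).hom.base '' C = C)
    (f : X ⟶ Y) (ρX : G →* Aut X) (hρf : ∀ g : G, (ρX g).hom ≫ f = f ≫ (ρY g).hom) {x : X}
    (hxD : f.base x ∈ D) (hdim : ringKrullDim (Y.presheaf.stalk (f.base x)) ≤ 1) {z : X} {g g' : G}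
    (hg : (ρX g).hom.base x ⤳ z) (hg' : (ρX g').hom.base x ⤳ z) :
    f.base ((ρX g).hom.base x) = f.base ((ρX g').hom.base x) := by
  -- `f (g x) = g (f x)`
  have hfg : ∀ a : G, f.base ((ρX a).hom.base x) = (ρY a).hom.base (f.base x) := fun a => by
    rw [← Scheme.Hom.comp_apply, hρf a, Scheme.Hom.comp_apply]
  have hmul : ∀ a b : G, (ρY a).hom.base ((ρY b).hom.base (f.base x)) = (ρY (a * b)).hom.base (f.base x) :=
    fun a b => by rw [map_mul, ← Scheme.Hom.comp_apply]; rfl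
  -- the component `C = cl{f(g x)}` and its translate by `h = g' g⁻¹`
  set η := f.base ((ρX g).hom.base x) with hηdef
  set η' := f.base ((ρX g').hom.base x) with hη'def
  set h : G := g' * g⁻¹ with hh
  have hhη : (ρY h).hom.base η = η' := by
    rw [hηdef, hη'def, hfg, hfg, hmul, hh, inv_mul_cancel_right]
  have hηD : η ∈ D := by
    rw [hηdef, hfg, ← hDG g]
    exact ⟨f.base x, hxD, rfl⟩
  have hdimη : ringKrullDim (Y.presheaf.stalk η) ≤ 1 := by
    rw [hηdef, hfg]
    have i := (asIso ((ρY g).hom.stalkMap (f.base x))).commRingCatIsoToRingEquiv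
    rw [ringKrullDim_eq_of_ringEquiv i]
    exact hdim
  have hmax := centreNew_maximal_closure_singleton hreg hD hηD hdimη
  have himage : (ρY h).hom.base '' closure {η} = closure {η'} := by
    have := (Scheme.homeoOfIso (ρY h)).image_closure {η}
    rw [Scheme.coe_homeoOfIso, Set.image_singleton] at this
    change (ρY h).hom.base '' closure {η} = closure {(ρY h).hom.base η} at this
    rw [this, hhη]
  -- both contain `f z`
  have hz : f.base z ∈ closure {η} := specializes_iff_mem_closure.mp (hg.map f.continuous)
  have hz' : f.base z ∈ closure {η'} := specializes_iff_mem_closure.mp (hg'.map f.continuous)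
  have heq := hDstrict h (closure {η}) hmax ⟨f.base z, hz, himage ▸ hz'⟩
  rw [himage] at heq
  -- equal closures have equal generic points
  have h1 : η' ⤳ η := by rw [specializes_iff_mem_closure, heq]; exact subset_closure rfl
  have h2 : η ⤳ η' := by rw [specializes_iff_mem_closure, ← heq]; exact subset_closure rfl
  exact (h2.antisymm h1).eq

/-! ## Stalk bookkeeping -/

/-- **A commutative square read on stalks.** For `φ' ≫ π = ρ' ≫ ι` and a point `y` of the corner,
the two composites `𝒪_{X,z} → 𝒪_{X,π(φ' y)} → 𝒪_{X₁,φ' y} → 𝒪_{P,y}` and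
`𝒪_{X,z} → 𝒪_{X,ι(ρ' y)} → 𝒪_{S,ρ' y} → 𝒪_{P,y}` agree, for any specializations to `z`.
[folklore] -/
theorem centreNew_stalkSpecializes_comp_stalkMap_eq {P X₁ X S : Scheme.{u}} (φ' : P ⟶ X₁)
    (π : X₁ ⟶ X) (ρ' : P ⟶ S) (ι : S ⟶ X) (hsq : φ' ≫ π = ρ' ≫ ι) (y : P) {z : X}
    (h₁ : π.base (φ'.base y) ⤳ z) (h₂ : ι.base (ρ'.base y) ⤳ z) :
    X.presheaf.stalkSpecializes h₁ ≫ π.stalkMap (φ'.base y) ≫ φ'.stalkMap y =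
      X.presheaf.stalkSpecializes h₂ ≫ ι.stalkMap (ρ'.base y) ≫ ρ'.stalkMap y := by
  rw [← Scheme.Hom.stalkMap_comp, ← Scheme.Hom.stalkMap_comp,
    Scheme.Hom.stalkMap_congr_hom _ _ hsq y]
  apply TopCat.Presheaf.stalk_hom_ext
  intro U hzU
  simp only [TopCat.Presheaf.stalkCongr_hom, TopCat.Presheaf.germ_stalkSpecializes_assoc]
  erw [TopCat.Presheaf.germ_stalkSpecializes_assoc]
  rfl

/-- **Along `Spec 𝒪_{X,z} → X`, the composite `𝒪_{X,z} → 𝒪_{X,x_𝔮} → 𝒪_{Spec 𝒪_{X,z},𝔮}` is the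
localization map** `𝒪_{X,z} ≅ Γ(Spec 𝒪_{X,z}) → 𝒪_{Spec 𝒪_{X,z},𝔮}` (Stacks 01J7; the case of the
closed point is Mathlib's `stalkClosedPointTo_fromSpecStalk`). [cite: StacksProject, Tag 01J7] -/
theorem centreNew_stalkSpecializes_stalkMap_fromSpecStalk {X : Scheme.{u}} (z : X)
    (𝔮 : Spec (X.presheaf.stalk z)) (h : (X.fromSpecStalk z).base 𝔮 ⤳ z) :
    X.presheaf.stalkSpecializes h ≫ (X.fromSpecStalk z).stalkMap 𝔮 =
      (Scheme.ΓSpecIso (X.presheaf.stalk z)).inv ≫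
        (Spec (X.presheaf.stalk z)).presheaf.germ ⊤ 𝔮 trivial := by
  apply TopCat.Presheaf.stalk_hom_ext
  intro U hzU
  rw [TopCat.Presheaf.germ_stalkSpecializes_assoc, Scheme.Hom.germ_stalkMap,
    Scheme.fromSpecStalk_app (X := X) (x := z) hzU, Category.assoc, Category.assoc,
    TopCat.Presheaf.germ_res]

end Summit.ResolutionOfSingularities.ResolutionOfSingularities.Theorems

end
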